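import Summits.AtomisticToContinuum.BoseEinsteinCondensation.Theses.BECLatticeDepthHomotopy

/-!
# Birth skeleton — crux `SparseToFull` (stmt-AtomisticToContinuum-12407)
# route `BECLatticeDepthHomotopy` (rank 4), file `Cruxes/SparseToFull/Lines/birth.lean`

The crux (by name, `Summit.AtomisticToContinuum.BoseEinsteinCondensation.Theses.BECLatticeDepthHomotopy.SparseToFull`):
for each repulsive finite-range `v`, ground-state BEC in the constant mode on the torus ALONG THE CUBES
`N = 4m³`, with constants uniform in the density `ρ < ρ₁`
(`ofReal (c·4m³) ≤ periodicCondensateNumber v (4m³) (sideLength ρ (4m³))`, eventually in `m`),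
implies `PeriodicBEC(v)` for ALL large `N` (the `∃ δ > 0, ∀ δ-near-minimiser` form that is verbatim the
hypothesis of the shared boundary-transfer item stmt-AtomisticToContinuum-0827).

The route header's foreseen two-child split is registered here as two NAMED stubs and a kernel-checked
composition:

* `stub_addParticles : AddParticles` — THE LOAD-BEARING STEP (open even for one added particle, card
  `one-particle-at-a-time`): at a FIXED torus of side `L` and density `≤ ρ₂(v, K, ε)`, adding
  `k = N - N'` particles with `k³ ≤ K N²` (i.e. `k ≲ N^{2/3}`, the cube gap) lowers the ground-state
  constant-mode condensate number by at most `ε N`, for all large `N`: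
  `periodicCondensateNumber v N' L ≤ periodicCondensateNumber v N L + ofReal (ε N)`.
  Stated in the weakest (sublinear-loss) form the composition needs; the per-particle Lipschitz form
  `n₀(N') ≤ n₀(N) + C k` and the monotone form `n₀(N') ≤ n₀(N) ` both imply it. NOT an energy-window
  statement: the `N'`-marginal of the `N`-particle ground state sits `O(k ρ a) ≫ 4π²N/L²` above
  `E₀(N')`, so by the Galilei-boost lemma of `KineticGapLengthScalesNarrow` no argument using only its
  energy can work — the proof must use the structure of the true ground state (positivity, translation
  invariance, the eigenvalue equation), which is why this is the crux's content and not glue.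
* `stub_densityShift : DensityShift` — the cube-below-`N` bookkeeping (provable now, size M in Lean):
  from the crux hypothesis, for every `ρ < ρ₁` and all large `N` there is a cube `N' = 4m³ ≤ N` with
  `(N - N')³ ≤ K N²` whose `N'` particles condense with `c N` IN THE `N`-BOX `sideLength ρ N`
  (density shift `ρ' = ρ N'/N ∈ (0, ρ₁)`, `sideLength ρ' N' = sideLength ρ N`; `K = 1372`, `c ↦ c/2`).

Composition `SparseToFull_of_stubs` (sorry-free, below): `ρ₀ = min ρ₁ ρ₂`, chain
`ofReal (c N) ≤ pCN v N' L ≤ pCN v N L + ofReal (c N / 2)` in `ℝ≥0∞`, deduce the STRICT bound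
`ofReal (c N / 4) < pCN v N L`, and unpack `sup_δ inf_Ψ` (order theory) into `∃ δ > 0, ∀ Ψ`.
`SparseToFull_of : SparseToFull` concludes the crux BY NAME from the two stubs.
-/

noncomputable section

namespace Summit.AtomisticToContinuum.BoseEinsteinCondensation.Cruxes.SparseToFull.Birth

open Literature.MathematicalPhysics.QuantumManyBody.BoseGas
open Literature.Barriers.AtomisticToContinuum.BoseGas
open _root_.Filter
open scoped ENNReal Topology
open Summit.AtomisticToContinuum.BoseEinsteinCondensation.Theses

/-! ### The two halves of the crux, at a fixed potential `v` (verbatim sub-terms of the route decl) -/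

/-- Hypothesis of `SparseToFull` at `v`: constant-mode ground-state BEC along the cubes `N = 4m³`,
constants uniform in the density `ρ < ρ₁`. -/
def CubeBEC (v : ℝ → ℝ≥0∞) : Prop :=
  ∃ ρ₁ c : ℝ, 0 < ρ₁ ∧ 0 < c ∧ ∀ᶠ m : ℕ in Filter.atTop, ∀ ρ : ℝ, 0 < ρ → ρ < ρ₁ → ENNReal.ofReal (c * ((4 * m ^ 3 : ℕ) : ℝ)) ≤ Literature.Barriers.AtomisticToContinuum.BoseGas.periodicCondensateNumber v (4 * m ^ 3) (Literature.MathematicalPhysics.QuantumManyBody.BoseGas.sideLength ρ (4 * m ^ 3))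

/-- Conclusion of `SparseToFull` at `v`: `PeriodicBEC(v)` — constant-mode occupation `≥ c N` of every
periodic `δ`-near-minimiser, some `δ > 0`, all large `N`, all small densities (verbatim the hypothesis
of stmt-AtomisticToContinuum-0827). -/
def PeriodicBECAt (v : ℝ → ℝ≥0∞) : Prop :=
  ∃ ρ₀ : ℝ, 0 < ρ₀ ∧ ∀ ρ : ℝ, 0 < ρ → ρ < ρ₀ → ∃ c : ℝ, 0 < c ∧ ∀ᶠ N : ℕ in Filter.atTop, ∃ δ : ENNReal, 0 < δ ∧ ∀ Ψ : Literature.MathematicalPhysics.QuantumManyBody.BoseGas.PeriodicTrialState N (Literature.MathematicalPhysics.QuantumManyBody.BoseGas.sideLength ρ N), Literature.MathematicalPhysics.QuantumManyBody.BoseGas.periodicEnergy v Ψ ≤ Literature.MathematicalPhysics.QuantumManyBody.BoseGas.periodicGroundStateEnergy v N (Literature.MathematicalPhysics.QuantumManyBody.BoseGas.sideLength ρ N) + δ → ENNReal.ofReal (c * N) ≤ Literature.MathematicalPhysics.QuantumManyBody.BoseGas.condensateOccupation N (Literature.MathematicalPhysics.QuantumManyBody.BoseGas.sideLength ρ N)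 Ψ.ψ

/-- The crux is literally `∀ v, IsRepulsiveFiniteRange v → CubeBEC v → PeriodicBECAt v`. -/
theorem sparseToFull_iff :
    BECLatticeDepthHomotopy.SparseToFull ↔
      ∀ v : ℝ → ℝ≥0∞, IsRepulsiveFiniteRange v → CubeBEC v → PeriodicBECAt v :=
  Iff.rfl

/-! ### Stub statements -/

/-- **AddParticles** (fixed box, sublinear loss). For every repulsive finite-range `v`, every cube-gap
constant `K > 0` and every `ε > 0` there is a density `ρ₂ > 0` such that for all large `N`, every
`N' ≤ N` with `(N - N')³ ≤ K N²` and every torus of side `L > 0` holding the `N` particles at density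
`N/L³ ≤ ρ₂`: the ground-state constant-mode condensate number of `N'` particles exceeds that of `N`
particles in the SAME box by at most `ε N`. -/
def AddParticles : Prop :=
  ∀ v : ℝ → ℝ≥0∞, IsRepulsiveFiniteRange v → ∀ K : ℝ, 0 < K → ∀ ε : ℝ, 0 < ε →
    ∃ ρ₂ : ℝ, 0 < ρ₂ ∧ ∀ᶠ N : ℕ in Filter.atTop, ∀ (N' : ℕ) (L : ℝ), 0 < L → N' ≤ N →
      ((N : ℝ) - N') ^ 3 ≤ K * (N : ℝ) ^ 2 → (N : ℝ) ≤ ρ₂ * L ^ 3 →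
        periodicCondensateNumber v N' L ≤ periodicCondensateNumber v N L + ENNReal.ofReal (ε * N)

/-- **DensityShift** (cube below `N`, bookkeeping; provable now). From BEC along the cubes with
constants uniform in the density: for every `ρ < ρ₁` and all large `N` some cube `N' = 4m³ ≤ N` within
the cube gap `(N - N')³ ≤ K N²` has its `N'` particles condensed with `c N` in the `N`-box
`sideLength ρ N` (`= sideLength (ρ N'/N) N'`, density `ρ N'/N ∈ (0, ρ₁)`). -/
def DensityShift : Prop :=
  ∀ v : ℝ → ℝ≥0∞, CubeBEC v →
    ∃ ρ₁ c K : ℝ, 0 < ρ₁ ∧ 0 < c ∧ 0 < K ∧ ∀ ρ : ℝ, 0 < ρ → ρ < ρ₁ → ∀ᶠ N : ℕ in Filter.atTop,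
      ∃ N' : ℕ, N' ≤ N ∧ ((N : ℝ) - N') ^ 3 ≤ K * (N : ℝ) ^ 2 ∧
        ENNReal.ofReal (c * N) ≤ periodicCondensateNumber v N' (sideLength ρ N)

/-! ### Registered stubs (signatures UNFOLDED into Literature-only vocabulary, fully qualified, so that
`propose --supports stmt-AtomisticToContinuum-12407` files can restate them verbatim without importing
this module; the `example`s below certify they are definitionally `AddParticles` / `DensityShift`) -/

/-- stub (XL, load-bearing) = `AddParticles`: particle-number continuity of the ground-state
constant-mode condensate number at fixed box, sublinear loss, cube-gap window, low density. -/
theorem stub_addParticles : ∀ v : ℝ → ENNReal, Literature.MathematicalPhysics.QuantumManyBody.BoseGas.IsRepulsiveFiniteRange v → ∀ K : ℝ, 0 < K → ∀ ε : ℝ, 0 < ε → ∃ ρ₂ : ℝ, 0 < ρ₂ ∧ ∀ᶠ N : ℕ in Filter.atTop, ∀ (N' : ℕ) (L : ℝ), 0 < L → N' ≤ N → ((N : ℝ) - N') ^ 3 ≤ K * (N : ℝ) ^ 2 → (N : ℝ) ≤ ρ₂ * L ^ 3 → Literature.Barriers.AtomisticToContinuum.BoseGas.periodicCondensateNumber v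 N' L ≤ Literature.Barriers.AtomisticToContinuum.BoseGas.periodicCondensateNumber v N L + ENNReal.ofReal (ε * N) := by
  sorry

/-- stub (M, provable now) = `DensityShift`: cube-below-`N` density-shift bookkeeping. -/
theorem stub_densityShift : ∀ v : ℝ → ENNReal, (∃ ρ₁ c : ℝ, 0 < ρ₁ ∧ 0 < c ∧ ∀ᶠ m : ℕ in Filter.atTop, ∀ ρ : ℝ, 0 < ρ → ρ < ρ₁ → ENNReal.ofReal (c * ((4 * m ^ 3 : ℕ) : ℝ)) ≤ Literature.Barriers.AtomisticToContinuum.BoseGas.periodicCondensateNumber v (4 * m ^ 3) (Literature.MathematicalPhysics.QuantumManyBody.BoseGas.sideLength ρ (4 * m ^ 3))) → ∃ ρ₁ c K : ℝ, 0 < ρ₁ ∧ 0 < c ∧ 0 < K ∧ ∀ ρ : ℝ, 0 < ρ → ρ < ρ₁ → ∀ᶠ N : ℕ in Filter.atTop, ∃ N' : ℕ, N' ≤ N ∧ ((N : ℝ) - N') ^ 3 ≤ K * (N : ℝ) ^ 2 ∧ ENNReal.ofReal (c * N) ≤ Literature.Barriers.AtomisticToContinuum.BoseGas.periodicCondensateNumber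 v N' (Literature.MathematicalPhysics.QuantumManyBody.BoseGas.sideLength ρ N) := by
  sorry

example : AddParticles := stub_addParticles
example : DensityShift := stub_densityShift

/-! ### Sorry-free glue -/

/-- Unpacking `sup_{δ>0} inf_Ψ`: a STRICT lower bound on the ground-state condensate number is
witnessed at some positive slack `δ` by every `δ`-near-minimiser. -/
theorem exists_slack_of_lt_periodicCondensateNumber {v : ℝ → ℝ≥0∞} {N : ℕ} {L : ℝ} {a : ℝ≥0∞}
    (h : a < periodicCondensateNumber v N L) :
    ∃ δ : ℝ≥0∞, 0 < δ ∧ ∀ Ψ : PeriodicTrialState N L,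
      periodicEnergy v Ψ ≤ periodicGroundStateEnergy v N L + δ → a ≤ condensateOccupation N L Ψ.ψ := by
  unfold periodicCondensateNumber at h
  obtain ⟨δ, hδ⟩ := lt_iSup_iff.1 h
  obtain ⟨hδpos, hlt⟩ := lt_iSup_iff.1 hδ
  exact ⟨δ, hδpos, fun Ψ hΨ => (hlt.trans_le (iInf₂_le Ψ hΨ)).le⟩

/-- `L = (N/ρ)^{1/3} > 0` for `N, ρ > 0`. -/
theorem sideLength_pos {ρ : ℝ} (hρ : 0 < ρ) {N : ℕ} (hN : 0 < N) : 0 < sideLength ρ N := by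
  unfold sideLength
  exact Real.rpow_pos_of_pos (div_pos (Nat.cast_pos.mpr hN) hρ) _

/-- `L³ = N/ρ` for `L = (N/ρ)^{1/3}`, `N, ρ > 0`. -/
theorem sideLength_pow_three {ρ : ℝ} (hρ : 0 < ρ) {N : ℕ} (hN : 0 < N) :
    sideLength ρ N ^ 3 = (N : ℝ) / ρ := by
  have hx : 0 ≤ (N : ℝ) / ρ := (div_pos (Nat.cast_pos.mpr hN) hρ).le
  unfold sideLength
  rw [← Real.rpow_natCast, ← Real.rpow_mul hx]
  norm_num

/-- **Composition** (the route's `AddParticles → DensityShift → glue`): the two stubs imply the crux,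
statement unfolded at `v`. -/
theorem SparseToFull_of_stubs (h₁ : AddParticles) (h₂ : DensityShift) :
    ∀ v : ℝ → ℝ≥0∞, IsRepulsiveFiniteRange v → CubeBEC v → PeriodicBECAt v := by
  intro v hv hcube
  obtain ⟨ρ₁, c, K, hρ₁, hc, hK, hshift⟩ := h₂ v hcube
  obtain ⟨ρ₂, hρ₂, hadd⟩ := h₁ v hv K hK (c / 2) (by positivity)
  refine ⟨min ρ₁ ρ₂, lt_min hρ₁ hρ₂, fun ρ hρ hρlt => ⟨c / 4, by positivity, ?_⟩⟩
  have hρ1 : ρ < ρ₁ := lt_of_lt_of_le hρlt (min_le_left _ _)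
  have hρ2 : ρ < ρ₂ := lt_of_lt_of_le hρlt (min_le_right _ _)
  filter_upwards [hshift ρ hρ hρ1, hadd, Filter.eventually_gt_atTop 0] with N hN hA hNpos
  obtain ⟨N', hle, hgap, hcond⟩ := hN
  have hNr : (0 : ℝ) < N := Nat.cast_pos.mpr hNpos
  have hL : 0 < sideLength ρ N := sideLength_pos hρ hNpos
  have hdens : (N : ℝ) ≤ ρ₂ * sideLength ρ N ^ 3 := by
    rw [sideLength_pow_three hρ hNpos, mul_div_assoc', le_div_iff₀ hρ, mul_comm]
    exact mul_le_mul_of_nonneg_right hρ2.le hNr.le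
  -- chain the two stubs in `ℝ≥0∞`
  have key : ENNReal.ofReal (c * N) ≤
      periodicCondensateNumber v N (sideLength ρ N) + ENNReal.ofReal (c / 2 * N) :=
    hcond.trans (hA N' (sideLength ρ N) hL hle hgap hdens)
  -- strict lower bound `c N / 4 < pCN v N L`
  have hlt : ENNReal.ofReal (c / 4 * N) < periodicCondensateNumber v N (sideLength ρ N) := by
    refine lt_of_not_ge fun h => ?_
    have h' := key.trans (add_le_add h le_rfl)
    rw [← ENNReal.ofReal_add (by positivity) (by positivity)] at h'
    have h'' := (ENNReal.ofReal_le_ofReal_iff (by positivity)).1 h'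
    nlinarith [mul_pos hc hNr]
  exact exists_slack_of_lt_periodicCondensateNumber hlt

/-- **Skeleton**: the crux BY NAME from the two registered stubs. -/
theorem SparseToFull_of : BECLatticeDepthHomotopy.SparseToFull :=
  sparseToFull_iff.2 (SparseToFull_of_stubs stub_addParticles stub_densityShift)

end Summit.AtomisticToContinuum.BoseEinsteinCondensation.Cruxes.SparseToFull.Birth

end
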